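import Summits.QuantumFields.QCD.Theorems.SpectralDefectExtinctionWegnerEstimateBallSamplingPullback
import Summits.QuantumFields.QCD.Theorems.SpectralDefectExtinctionWegnerEstimatePortRigidityFaces

/-!
# Stub `portRigidity` of line `Sketch` (skeleton "ResolventCell", gen 2c) for crux
`SpectralDefectExtinction.WegnerEstimate` (item stmt-QuantumFields-8966)

The rigidity inequality (ii) of `stub_currentRigidity` for the junk-free port min-functional `bad := badPort R`
of the landed `…SketchDefs` (gen 2c), with `c₀ = 1`, `k = 1`, `R' = R − 1` — a TAUTOLOGY of the infimum once the
pull-back of a genuine torus eigenvector is recognised as an admissible competitor: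

for an eigenvector `Γ₅ D_W(W, m₀, 1) ψ = λ ψ` (`|λ| ≤ 1`, `m₀ ∈ [−1, 0]`) on any torus `L ≥ 1` and ANY configuration
`W` (in the stub: the glued one `glue_{x,R}(U, V)`), restrict `ψ` to the port domain around `x`,
`φ(y) = ψ(x + proj y)` (`y ∈ portDomain R`).  Then
* the interior residual of `φ` vanishes (landed `ballSampling_portInteriorResSq_pullback_eq_zero`: sampling
  identity `latticeApply = Γ₅ D_W` on `box (R−1)`),
* the port-projected face residual vanishes (bridge `portRigidity_portFaceResSq_pullback_eq_zero`: the port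
  projector kills the one cut-off outward hop),
* every cube current of `φ` is the corresponding torus current of `ψ` or `0` (landed
  `ballSampling_abs_latticeCurrent_read_le`), so `portCurrentSum R w φ ≤ Σ |J|`,
* `boxMass ψ (image of box (R−1)) ≤ portNormSq R φ =: s` (landed `ballSampling_boxMass_le_portNormSq`);
normalising `φ₁ = φ/√s` (all three terms of the functional are 2-homogeneous; `portRigidity_latticeCurrent_smul`)
gives an admissible unit competitor, whence `badPort R w ≤ portCurrentSum R w φ / s` (`csInf_le`) and
`badPort R w · boxMass ≤ badPort R w · s ≤ Σ |J|` (`portRigidity_of_pos`).  For `R = 0` the port domain is empty and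
`badPort 0 = sInf ∅ = 0` (`portRigidity_badPort_zero`).
-/

noncomputable section

namespace Summit.QuantumFields.QCD.Cruxes.WegnerEstimate.ResolventCell

open scoped Matrix BigOperators
open Literature.MathematicalPhysics.QuantumLattice Literature.MathematicalPhysics.QuantumFieldTheory
  Literature.Probability.LatticeModels
open Matrix

/-! ### Homogeneity of the current and the degenerate radius -/

/-- Homogeneity of the colour current: scaling the field by a real `c` scales every current by `c²`. -/
theorem portRigidity_latticeCurrent_smul (c : ℝ) (w : LinkData) (v : (Fin 4 → ℤ) → Fin 3 → Fin 4 → ℂ)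
    (y : Fin 4 → ℤ) (μ : Fin 4) (i : Fin 8) :
    latticeCurrent w (fun z b γ => (c : ℂ) * v z b γ) y μ i = c ^ 2 * latticeCurrent w v y μ i := by
  simp only [latticeCurrent]
  have hc : star (c : ℂ) = c := Complex.conj_ofReal c
  have h : ∀ a b α β, star ((c : ℂ) * v y a α) * fwdHop μ α β *
      (((w (y, μ) : SU3) : Matrix (Fin 3) (Fin 3) ℂ) * su3Basis i) a b * ((c : ℂ) * v (y + Pi.single μ 1) b β) =
      ((c * c : ℝ) : ℂ) * (star (v y a α) * fwdHop μ α β *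
        (((w (y, μ) : SU3) : Matrix (Fin 3) (Fin 3) ℂ) * su3Basis i) a b * v (y + Pi.single μ 1) b β) := by
    intro a b α β
    rw [star_mul', hc]
    push_cast
    ring
  simp only [h, ← Finset.mul_sum, Complex.re_ofReal_mul]
  ring

/-- `badPort 0 = 0`: the port domain of radius `0` is empty, so no port field has unit norm and the infimum is
over the empty set. -/
theorem portRigidity_badPort_zero (w : LinkData) : badPort 0 w = 0 := by
  rw [badPort]
  convert Real.sInf_empty
  rw [Set.eq_empty_iff_forall_notMem]
  rintro r ⟨m₀, lam, φ, -, -, -, h1, -⟩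
  have h0 : portNormSq 0 φ = 0 := by
    rw [portNormSq]
    have : IsEmpty (↥(portDomain 0) × Fin 3 × Fin 4) := by
      have : IsEmpty ↥(portDomain 0) := ⟨fun p => ballSampling_not_mem_portDomain_zero p.1 p.2⟩
      infer_instance
    exact Fintype.sum_empty _
  rw [h0] at h1
  exact zero_ne_one h1

/-! ### The rigidity inequality for an arbitrary configuration -/

/-- **The port rigidity inequality, `R ≥ 1`, arbitrary torus configuration `W`** (links read around `x`;
right-hand side written with `fwdHop` / `su3Basis`, by `rfl` the registered current summands). -/
theorem portRigidity_of_pos {R L : ℕ} [NeZero L] (hR : 1 ≤ R) (x : TorusSite 4 L) (m₀ : ℝ) (hm₀ : -1 ≤ m₀)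
    (hm₀' : m₀ ≤ 0) (W : GaugeConfig 4 L SU3) (ψ : QuarkIdx L → ℂ) (lam : ℝ) (hlam : |lam| ≤ 1)
    (hψ : (spinorLift gammaFive * wilsonDirac (fundamentalRep (Fin 3)) W m₀ 1).mulVec ψ = (lam : ℂ) • ψ) :
    badPort R (fun l => W (x + Torus.proj L l.1, l.2)) *
        boxMass ψ ((box 4 (R - 1)).image fun y => x + Torus.proj L y) ≤
      ∑ y ∈ box 4 R, ∑ μ : Fin 4, ∑ i : Fin 8,
        |2 * (∑ a : Fin 3, ∑ b : Fin 3, ∑ α : Fin 4, ∑ β : Fin 4,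
          star (ψ (x + Torus.proj L y, a, α)) * fwdHop μ α β *
            (((W (x + Torus.proj L y, μ) : SU3) : Matrix (Fin 3) (Fin 3) ℂ) * su3Basis i) a b *
            ψ (Literature.MathematicalPhysics.QuantumFieldTheory.Site.shift (x + Torus.proj L y) μ, b, β)).re| := by
  set w : LinkData := fun l => W (x + Torus.proj L l.1, l.2) with hw
  -- the pull-back port field of a torus vector
  set pull : (QuarkIdx L → ℂ) → PortField R := fun ψ' p => ψ' (x + Torus.proj L (p.1 : Fin 4 → ℤ), p.2.1, p.2.2)
    with hpull
  have hnormSq : ∀ ψ' : QuarkIdx L → ℂ, portNormSq R (pull ψ') =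
      ∑ y ∈ portDomain R, ∑ a : Fin 3, ∑ α : Fin 4, ‖ψ' (x + Torus.proj L y, a, α)‖ ^ 2 := fun ψ' =>
    ballSampling_portNormSq_pullback ψ' x
  -- (A) mass ≤ port norm
  have hmass : boxMass ψ ((box 4 (R - 1)).image fun y => x + Torus.proj L y) ≤ portNormSq R (pull ψ) :=
    ballSampling_boxMass_le_portNormSq hR ψ x
  -- (B) currents ≤ RHS, termwise (each cube current of the pull-back is the torus current or `0`)
  have hcur : portCurrentSum R w (pull ψ) ≤
      ∑ y ∈ box 4 R, ∑ μ : Fin 4, ∑ i : Fin 8,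
        |2 * (∑ a : Fin 3, ∑ b : Fin 3, ∑ α : Fin 4, ∑ β : Fin 4,
          star (ψ (x + Torus.proj L y, a, α)) * fwdHop μ α β *
            (((W (x + Torus.proj L y, μ) : SU3) : Matrix (Fin 3) (Fin 3) ℂ) * su3Basis i) a b *
            ψ (Literature.MathematicalPhysics.QuantumFieldTheory.Site.shift (x + Torus.proj L y) μ, b, β)).re| :=
    Finset.sum_le_sum fun y _ => Finset.sum_le_sum fun μ _ => Finset.sum_le_sum fun i _ =>
      ballSampling_abs_latticeCurrent_read_le x W ψ _ (ballSampling_portVal_pullback_cutoff x ψ) y μ i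
  have hRHS : 0 ≤ ∑ y ∈ box 4 R, ∑ μ : Fin 4, ∑ i : Fin 8,
        |2 * (∑ a : Fin 3, ∑ b : Fin 3, ∑ α : Fin 4, ∑ β : Fin 4,
          star (ψ (x + Torus.proj L y, a, α)) * fwdHop μ α β *
            (((W (x + Torus.proj L y, μ) : SU3) : Matrix (Fin 3) (Fin 3) ℂ) * su3Basis i) a b *
            ψ (Literature.MathematicalPhysics.QuantumFieldTheory.Site.shift (x + Torus.proj L y) μ, b, β)).re| :=
    Finset.sum_nonneg fun _ _ => Finset.sum_nonneg fun _ _ => Finset.sum_nonneg fun _ _ => abs_nonneg _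
  have hbad : 0 ≤ badPort R w := badPort_nonneg R w
  have hs0 : 0 ≤ portNormSq R (pull ψ) := Finset.sum_nonneg fun _ _ => by positivity
  rcases hs0.eq_or_lt with hs | hs
  · -- the pull-back vanishes identically: so does the mass
    calc badPort R w * boxMass ψ ((box 4 (R - 1)).image fun y => x + Torus.proj L y)
        ≤ badPort R w * portNormSq R (pull ψ) := mul_le_mul_of_nonneg_left hmass hbad
      _ = 0 := by rw [← hs, mul_zero]
      _ ≤ _ := hRHS
  · -- normalise: `ψ₁ = ψ / √s` is an admissible UNIT competitor with the same (zero) residuals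
    set s := portNormSq R (pull ψ) with hs_def
    set c : ℝ := (Real.sqrt s)⁻¹ with hc
    have hc0 : 0 ≤ c := inv_nonneg.mpr (Real.sqrt_nonneg s)
    have hcs : c ^ 2 * s = 1 := by
      rw [hc, inv_pow, Real.sq_sqrt hs.le, inv_mul_cancel₀ hs.ne']
    obtain ⟨ψ₁, hψ₁⟩ : ∃ ψ₁ : QuarkIdx L → ℂ, ψ₁ = fun j => (c : ℂ) * ψ j := ⟨_, rfl⟩
    have hψ₁eig : (spinorLift gammaFive * wilsonDirac (fundamentalRep (Fin 3)) W m₀ 1).mulVec ψ₁ =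
        (lam : ℂ) • ψ₁ := by
      have : ψ₁ = (c : ℂ) • ψ := by rw [hψ₁]; rfl
      rw [this, Matrix.mulVec_smul, hψ, smul_comm]
    have hnorm : portNormSq R (pull ψ₁) = 1 := by
      rw [hnormSq, ← hcs, hs_def, hnormSq, Finset.mul_sum]
      refine Finset.sum_congr rfl fun y _ => ?_
      rw [Finset.mul_sum]
      refine Finset.sum_congr rfl fun a _ => ?_
      rw [Finset.mul_sum]
      refine Finset.sum_congr rfl fun α _ => ?_
      rw [hψ₁, norm_mul, mul_pow, Complex.norm_of_nonneg hc0]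
    have hval : portVal (pull ψ₁) = fun z b γ => (c : ℂ) * portVal (pull ψ) z b γ := by
      funext z b γ
      rw [hpull, ballSampling_portVal_pullback, ballSampling_portVal_pullback, hψ₁]
      split_ifs
      · rfl
      · rw [mul_zero]
    have hcur₁ : portCurrentSum R w (pull ψ₁) = c ^ 2 * portCurrentSum R w (pull ψ) := by
      rw [portCurrentSum, portCurrentSum, hval, Finset.mul_sum]
      refine Finset.sum_congr rfl fun y _ => ?_
      rw [Finset.mul_sum]
      refine Finset.sum_congr rfl fun μ _ => ?_
      rw [Finset.mul_sum]
      refine Finset.sum_congr rfl fun i _ => ?_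
      rw [portRigidity_latticeCurrent_smul, abs_mul, abs_of_nonneg (sq_nonneg c)]
    have hint : portInteriorResSq R m₀ lam w (pull ψ₁) = 0 :=
      ballSampling_portInteriorResSq_pullback_eq_zero x W m₀ lam ψ₁ hψ₁eig
    have hface : portFaceResSq R m₀ lam w (pull ψ₁) = 0 :=
      portRigidity_portFaceResSq_pullback_eq_zero x W m₀ lam ψ₁ hψ₁eig
    have hle : badPort R w ≤ c ^ 2 * portCurrentSum R w (pull ψ) := by
      refine csInf_le ⟨0, ?_⟩ ⟨m₀, lam, pull ψ₁, hm₀, hm₀', hlam, hnorm, ?_⟩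
      · rintro r ⟨m₁, lam₁, φ, -, -, -, -, rfl⟩
        exact add_nonneg (add_nonneg (portCurrentSum_nonneg R w φ) (portInteriorResSq_nonneg R m₁ lam₁ w φ))
          (portFaceResSq_nonneg R m₁ lam₁ w φ)
      · rw [hint, hface, add_zero, add_zero, hcur₁]
    calc badPort R w * boxMass ψ ((box 4 (R - 1)).image fun y => x + Torus.proj L y)
        ≤ badPort R w * s := mul_le_mul_of_nonneg_left hmass hbad
      _ ≤ c ^ 2 * portCurrentSum R w (pull ψ) * s := mul_le_mul_of_nonneg_right hle hs.le
      _ = portCurrentSum R w (pull ψ) := by rw [mul_comm (c ^ 2), mul_assoc, hcs, mul_one]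
      _ ≤ _ := hcur

/-! ### The stub -/

/-- **Stub `portRigidity`** (the rigidity inequality (ii) of `stub_currentRigidity` for `bad := badPort R`,
`c₀ = 1`, `k = 1`, `R' = R − 1`), verbatim the registered statement: for a genuine eigenvector `ψ` (`|λ| ≤ 1`) of
`Γ₅ D_W(glue_{x,R}(U, V), m₀, 1)` on any torus `L ≥ 2`,
`badPort R (glue read around x) · boxMass ψ (x + box (R−1)) ≤ Σ_{y ∈ box R, μ, i} |J_{(x + proj y, μ), X_i}(ψ)|`. -/
theorem stub_portRigidity : ∀ (R : ℕ) (L : ℕ) [NeZero L], 2 ≤ L → ∀ (x : TorusSite 4 L) (m₀ : ℝ), -1 ≤ m₀ → m₀ ≤ 0 →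
    ∀ (U V : GaugeConfig 4 L SU3) (ψ : QuarkIdx L → ℂ) (lam : ℝ), |lam| ≤ 1 →
    (spinorLift gammaFive * wilsonDirac (fundamentalRep (Fin 3))
        (fun e => if (∃ y ∈ box 4 R, e.1 = x + Torus.proj L y) then V e else U e) m₀ 1).mulVec ψ =
      (lam : ℂ) • ψ →
    badPort R (fun l => (fun e : Edge 4 L => if (∃ y ∈ box 4 R, e.1 = x + Torus.proj L y) then V e else U e)
        (x + Torus.proj L l.1, l.2)) *
        boxMass ψ ((box 4 (R - 1)).image fun y => x + Torus.proj L y) ≤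
      ∑ y ∈ box 4 R, ∑ μ : Fin 4, ∑ i : Fin 8,
              |2 * (∑ a : Fin 3, ∑ b : Fin 3, ∑ α : Fin 4, ∑ β : Fin 4,
                  star (ψ (x + Torus.proj L y, a, α)) *
                    (gammaFive * ((-(1 / 2 : ℂ)) • ((1 : Matrix (Fin 4) (Fin 4) ℂ) - euclideanGamma μ))) α β *
                    ((((fun e : Edge 4 L => if (∃ y ∈ box 4 R, e.1 = x + Torus.proj L y) then V e else U e)
                          (x + Torus.proj L y, μ) : SU3) : Matrix (Fin 3) (Fin 3) ℂ) *
                        (![!![0, 1, 0; -1, 0, 0; 0, 0, 0], !![0, 0, 1; 0, 0, 0; -1, 0, 0],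
                           !![0, 0, 0; 0, 0, 1; 0, -1, 0], !![0, Complex.I, 0; Complex.I, 0, 0; 0, 0, 0],
                           !![0, 0, Complex.I; 0, 0, 0; Complex.I, 0, 0],
                           !![0, 0, 0; 0, 0, Complex.I; 0, Complex.I, 0],
                           !![Complex.I, 0, 0; 0, -Complex.I, 0; 0, 0, 0],
                           !![0, 0, 0; 0, Complex.I, 0; 0, 0, -Complex.I]] i : Matrix (Fin 3) (Fin 3) ℂ)) a b *
                    ψ (Literature.MathematicalPhysics.QuantumFieldTheory.Site.shift (x + Torus.proj L y) μ,
                      b, β)).re| := by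
  intro R L _ hL x m₀ hm₀ hm₀' U V ψ lam hlam hψ
  rcases Nat.eq_zero_or_pos R with rfl | hR
  · rw [portRigidity_badPort_zero, zero_mul]
    exact Finset.sum_nonneg fun _ _ => Finset.sum_nonneg fun _ _ => Finset.sum_nonneg fun _ _ => abs_nonneg _
  · -- infer the glued configuration from `hψ` (a `_` solved against the goal's glue β-redex times out); `exact`
    -- then closes the registered shape by unfolding `fwdHop`, `su3Basis` and β-reducing the glue
    have key := portRigidity_of_pos hR x m₀ hm₀ hm₀' _ ψ lam hlam hψ
    exact key

end Summit.QuantumFields.QCD.Cruxes.WegnerEstimate.ResolventCell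

end
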